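import Literature.Combinatorics.Enumerative.SporadicS18TermProofs
import Mathlib.NumberTheory.Padics.PadicVal.Basic
import Mathlib.Tactic
import HarnessLib

/-!
# Osburn–Sahu–Straub 2016, Theorem 1.3 — III: `s₁₈(mp^r) ≡ s₁₈(mp^{r−1}) (mod p^{2r})` for every prime (discharge of `oss2016_theorem13`)

Topic `Literature/Combinatorics/Enumerative`, namespace `Literature.Combinatorics.Enumerative.SporadicS18Proofs`; the
last of the three files. Everything here is PROVED (theorems only; no definitions, no named facts). HONEST FRAMING
(cell pub-zeta5, D2 lens): a classical supercongruence (Osburn–Sahu–Straub 2016, Theorem 1.3) for Cooper's sporadic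
sequence `s₁₈` made a theorem of the tree; nothing about `ζ(5)` or any irrationality statement.

Assembly, exactly as printed: `s₁₈(np) = Σ_{p ∣ k} 𝒟(np,k) + Σ_{p ∤ k} 𝒟(np,k)`; the second sum is `≡ 0 (mod p^{2v_p(np)})`
termwise (`pow_dvd_summand_of_not_dvd`), the first is `Σ_{k'} 𝒟(np, k'p) ≡ Σ_{k'} 𝒟(n, k') = s₁₈(n)` termwise modulo
`p^{2v_p(n)+2}` (`pow_dvd_summand_mul_prime_sub`); with `n = mp^{r−1}` this is Theorem 1.3 (no induction on `r` is needed).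

* `s18_eq_sum_range` — for `n ≥ 1` the printed sum over `k ≤ n/3` equals the sum over `k ≤ n` (the extra summands vanish);
* `pow_dvd_s18_mul_prime_sub` — `p^{2 v_p(n) + 2} ∣ s₁₈(np) − s₁₈(n)` (`n ≥ 1`, every prime `p`);
* `oss2016_theorem13_holds : AperyGaussCongruences.oss2016_theorem13`.

References: [OsburnSahuStraub2016] Theorem 1.3 (13) and §2 (proof); [Straub2014] Lemma 5.1 (41).
-/

open Finset

namespace Literature.Combinatorics.Enumerative.SporadicS18Proofs

open AperyGaussCongruences (s18)

/-- For `n ≥ 1`, `s₁₈(n) = Σ_{k=0}^{n} 𝒟(n,k)`: the summands with `n/3 < k ≤ n` vanish. [cite: OsburnSahuStraub2016, (7)] -/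
theorem s18_eq_sum_range {n : ℕ} (hn : 1 ≤ n) :
    s18 n = ∑ k ∈ range (n + 1), (-1 : ℤ) ^ k * ((n.choose k * (2 * k).choose k * (2 * (n - k)).choose (n - k) *
        ((2 * n - 3 * k - 1).choose n + (2 * n - 3 * k).choose n) : ℕ) : ℤ) := by
  rw [s18, if_neg (by omega)]
  apply Finset.sum_subset (Finset.range_mono (by omega : n / 3 + 1 ≤ n + 1))
  intro k hk hk'
  rw [mem_range] at hk hk'
  have h3 : n < 3 * k := by omega
  rw [summand_eq_zero_of_lt hn h3]
  simp

/-- **`p^{2 v_p(n) + 2} ∣ s₁₈(np) − s₁₈(n)`** for every prime `p` and `n ≥ 1`: split `s₁₈(np)` by `p ∣ k`; the multiples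
`k = k'p` pair off with the summands of `s₁₈(n)` (`pow_dvd_summand_mul_prime_sub`), the others vanish modulo
`p^{2 v_p(np)}` (`pow_dvd_summand_of_not_dvd`). [cite: OsburnSahuStraub2016, §2 (proof of Theorem 1.3, assembly)] -/
theorem pow_dvd_s18_mul_prime_sub (p : ℕ) [hp : Fact p.Prime] {N : ℕ} (hN : 1 ≤ N) :
    (p : ℤ) ^ (2 * padicValNat p N + 2) ∣ s18 (N * p) - s18 N := by
  have hp' := hp.out
  have hNp : 1 ≤ N * p := Nat.one_le_iff_ne_zero.mpr (Nat.mul_ne_zero (by omega) hp'.ne_zero)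
  rw [s18_eq_sum_range hNp, s18_eq_sum_range hN,
    ← Finset.sum_filter_add_sum_filter_not (range (N * p + 1)) (fun k => p ∣ k)]
  -- the multiples of `p` in `range (N p + 1)` are the `k' p`, `k' ≤ N`
  have hfilter : (range (N * p + 1)).filter (fun k => p ∣ k) =
      (range (N + 1)).map ⟨fun k' => k' * p, mul_left_injective₀ hp'.ne_zero⟩ := by
    ext k
    simp only [mem_filter, mem_range, mem_map, Function.Embedding.coeFn_mk]
    constructor
    · rintro ⟨hk, ⟨k', rfl⟩⟩
      refine ⟨k', ?_, by ring⟩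
      have : p * k' ≤ p * N := by rw [mul_comm p N]; omega
      have := Nat.le_of_mul_le_mul_left this hp'.pos
      omega
    · rintro ⟨k', hk', rfl⟩
      refine ⟨?_, Dvd.intro_left _ rfl⟩
      have := Nat.mul_le_mul_right p (show k' ≤ N by omega)
      omega
  rw [hfilter, Finset.sum_map]
  have key : ∀ A B C : ℤ, A + B - C = (A - C) + B := fun A B C => by ring
  rw [key, ← Finset.sum_sub_distrib]
  refine dvd_add (Finset.dvd_sum fun k' hk' => ?_) (Finset.dvd_sum fun k hk => ?_)
  · simp only [Function.Embedding.coeFn_mk]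
    exact pow_dvd_summand_mul_prime_sub p hN (by rw [mem_range] at hk'; omega)
  · have hk' : ¬ p ∣ k := (mem_filter.mp hk).2
    refine (pow_dvd_pow _ ?_).trans (pow_dvd_summand_of_not_dvd p (n := N * p) hk')
    rw [padicValNat.mul (by omega) hp'.ne_zero, padicValNat_self]
    omega

/-- **Osburn–Sahu–Straub 2016, Theorem 1.3** — DISCHARGE of the named fact `AperyGaussCongruences.oss2016_theorem13`:
«For any integers `m, r ≥ 1` and any primes `p`, we have (13) `s₁₈(mp^r) ≡ s₁₈(mp^{r−1}) (mod p^{2r})`», for Cooper's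
sporadic sequence `s₁₈(n) = Σ_{k} (−1)^k C(n,k) C(2k,k) C(2(n−k),n−k) [C(2n−3k−1,n) + C(2n−3k,n)]` (1, 6, 54, 564, 6390, …).
Proof = the printed one (§2): Jacobsthal's binomial congruence in unit-ratio form for the four binomial factors of the summand —
for `p ≥ 5` (one power short of) the tree's `Jacobsthal.exists_ratio`, for `p = 3` and `p = 2` the weak laws
`JacobsthalWeak.exists_ratio_odd` / `exists_ratio_two` ([Straub2014] (41) with the factor `1/12` and the sign `ε`) — plus
super-Catalan integrality for the summands with `p ∤ k`. [cite: OsburnSahuStraub2016, Theorem 1.3 (13)] -/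
theorem oss2016_theorem13_holds : AperyGaussCongruences.oss2016_theorem13 := by
  intro p hp m r hm hr
  haveI : Fact p.Prime := ⟨hp⟩
  obtain ⟨r, rfl⟩ : ∃ r', r = r' + 1 := ⟨r - 1, by omega⟩
  rw [Nat.add_sub_cancel, pow_succ, ← mul_assoc]
  have hN : 1 ≤ m * p ^ r := Nat.one_le_iff_ne_zero.mpr (Nat.mul_ne_zero (by omega) (pow_ne_zero _ hp.ne_zero))
  have h := pow_dvd_s18_mul_prime_sub p hN
  have hv : r ≤ padicValNat p (m * p ^ r) := by
    rw [padicValNat.mul (by omega) (pow_ne_zero _ hp.ne_zero), padicValNat.prime_pow]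
    omega
  have h' : (p : ℤ) ^ (2 * (r + 1)) ∣ s18 (m * p ^ r * p) - s18 (m * p ^ r) :=
    (pow_dvd_pow _ (by omega)).trans h
  exact (Int.modEq_iff_dvd.mpr h').symm

end Literature.Combinatorics.Enumerative.SporadicS18Proofs
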